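import Summits.Langlands.Langlands.Theorems.MonomialConverseAbelianFreeBrauerLinear
import Literature.RepresentationTheory.FiniteGroups.CliffordCorrespondence

/-!
# Abelian-free Brauer induction, V: the affine branch (Clifford correspondence)

Part of the sorry-free proof of the crux `Summit.Langlands.Langlands.Theses.MonomialConverse.AbelianFreeBrauer`
(item stmt-Langlands-18580, route-Langlands-MonomialConverse), split over the files
`MonomialConverseAbelianFreeBrauer{Span, Linear, Moves, Hubs, Affine, Expansion, Proof}` (landing
order; all definitions live in `Span`, the last file holds `abelianFreeBrauer_proof` and the proof
outline).  Everything is over the in-tree class-function library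
`Literature.RepresentationTheory.FiniteGroups` (`indClassFun`, `classInner`, `virtChars`, `IsIrrChar`);
no `sorry`, no new axioms, no `Prop`-valued definitions (predicates are sets).

Contents: `indOne_sub_one_mem_afSpan_affine` — for `V ⊴ G` commutative with a complement `K`
(`V ⊓ K = ⊥`, `V ⊔ K = ⊤`) and every linear character of `G` trivial on `V`, `π_K - 1 ∈ J(G)`.
`π_K - 1` is a character whose restriction to `V` contains every nontrivial `ψ ∈ Irr(V)` exactly once
and not `1_V` (`classInner_restrict_indOne`); peeling off irreducible constituents by induction on the
degree (`mem_afSpan_of_mult`, multiplicities being natural numbers), each constituent `χ` is, by the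
Clifford correspondence (Isaacs Thm. 6.11, `exists_indClassFun_eq_of_inertia`), induced from a linear
character `η` of the inertia group `I_G(ψ)` extending some `ψ ≠ 1_V`, hence abelian-free
(`constituent_mem_afSpan`).

References: Isaacs, *Character Theory of Finite Groups* (`Isaacs1976`) Thm. 6.2, Thm. 6.11.
-/

set_option linter.dupNamespace false

noncomputable section

open scoped BigOperators Pointwise

namespace Summit.Langlands.Langlands.Theorems.AbelianFreeBrauer

open Literature.RepresentationTheory.FiniteGroups

variable {G : Type} [Group G]

/-! ### The affine branch: `π_K - 1 ∈ J(G)` for a complement `K` of a commutative normal `V` on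
which every linear character of `G` is trivial (Clifford correspondence) -/

section Affine

variable [Fintype G]

/-- `π_K(1) = [G : K]`. [folklore] -/
theorem indOne_apply_one (K : Subgroup G) : indOne K 1 = (K.index : ℂ) := by
  classical
  rw [indOne, indClassFun_apply]
  have h : ∀ t : G, Function.extend Subtype.val (fun _ : K => (1 : ℂ)) 0 (t⁻¹ * 1 * t) = 1 := by
    intro t
    rw [mul_one, inv_mul_cancel]
    exact extend_subtypeVal_apply K _ ⟨1, K.one_mem⟩
  simp_rw [h]
  rw [Finset.sum_const, Finset.card_univ, nsmul_eq_mul, mul_one, ← Nat.card_eq_fintype_card,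
    ← Subgroup.index_mul_card K, Nat.cast_mul]
  have hK : (Nat.card K : ℂ) ≠ 0 := by exact_mod_cast Nat.card_pos.ne'
  rw [mul_comm (K.index : ℂ), ← mul_assoc, inv_mul_cancel₀ hK, one_mul]

/-- For `V ⊴ G` with `V ⊓ K = ⊥`, `π_K` vanishes on `V ∖ {1}`. [folklore] -/
theorem indOne_apply_eq_zero_of_mem (V K : Subgroup G) [hVn : V.Normal] (hVK : V ⊓ K = ⊥)
    {v : G} (hv : v ∈ V) (hv1 : v ≠ 1) : indOne K v = 0 := by
  classical
  rw [indOne, indClassFun_apply]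
  have h : ∀ t : G, Function.extend Subtype.val (fun _ : K => (1 : ℂ)) 0 (t⁻¹ * v * t) = 0 := by
    intro t
    apply extend_subtypeVal_of_not_mem K
    intro ht
    have hv' : t⁻¹ * v * t ∈ V := by simpa using hVn.conj_mem v hv t⁻¹
    have h1 : t⁻¹ * v * t ∈ V ⊓ K := Subgroup.mem_inf.mpr ⟨hv', ht⟩
    rw [hVK, Subgroup.mem_bot] at h1
    apply hv1
    have h2 := congrArg (fun y => t * y * t⁻¹) h1
    simpa [mul_assoc] using h2
  simp_rw [h]
  rw [Finset.sum_const_zero, mul_zero]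

/-- `[(π_K)_V, ψ]_V = 1` for `ψ` with `ψ(1) = 1`, when `V ⊓ K = ⊥` and `[G : K] = |V|`
(`(π_K)_V` is the regular character of `V`). [folklore] -/
theorem classInner_restrict_indOne (V K : Subgroup G) [V.Normal] [Fintype V] (hVK : V ⊓ K = ⊥)
    (hidx : K.index = Nat.card V) {ψ : V → ℂ} (hψ1 : ψ 1 = 1) :
    classInner (fun v : V => indOne K v) ψ = 1 := by
  classical
  rw [classInner_apply, Finset.sum_eq_single (1 : V)]
  · rw [OneMemClass.coe_one, indOne_apply_one, inv_one, hψ1, mul_one, hidx,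
      Nat.card_eq_fintype_card, inv_mul_cancel₀]
    exact_mod_cast Fintype.card_pos.ne'
  · intro v _ hv1
    rw [indOne_apply_eq_zero_of_mem V K hVK v.2 (fun h => hv1 (Subtype.ext h)), zero_mul]
  · intro h
    exact absurd (Finset.mem_univ _) h

/-- `[φ - φ', ψ] = [φ, ψ] - [φ', ψ]`. [folklore] -/
theorem classInner_sub_left' {A : Type} [Group A] [Fintype A] (φ φ' ψ : A → ℂ) :
    classInner (φ - φ') ψ = classInner φ ψ - classInner φ' ψ := by
  simp only [classInner_apply, Pi.sub_apply, sub_mul, Finset.sum_sub_distrib, mul_sub]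

/-- **The constituent step.** Let `V ⊴ G` be commutative with every linear character of `G`
trivial on `V`, and let `χ ∈ Irr(G)` be such that every irreducible constituent `ψ` of `χ_V` is
nontrivial of multiplicity one.  Then `χ ∈ J(G)`: by the Clifford correspondence
(Isaacs Thm. 6.11) `χ = η^G` with `η ∈ Irr(I_G(ψ))` and `[η_V, ψ] = [χ_V, ψ] = 1`, so `η` is a
linear character extending `ψ ≠ 1_V`; as every linear character of `G` is trivial on `V`, `η` is
abelian-free and `χ = Ind η` is a generator of `J(G)`. [cite: Isaacs1976, Thm. 6.11] -/
theorem constituent_mem_afSpan (V : Subgroup G) [hVn : V.Normal] [Fintype V]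
    (hVc : ∀ x ∈ V, ∀ y ∈ V, x * y = y * x) (htriv : ∀ μ : G →* ℂˣ, V ≤ μ.ker)
    {χ : G → ℂ} (hχ : IsIrrChar G χ)
    (hmult : ∀ ψ : V → ℂ, IsIrrChar V ψ → classInner (fun v : V => χ v) ψ ≠ 0 →
      classInner (fun v : V => χ v) ψ = 1 ∧ ψ ≠ 1) :
    χ ∈ afSpan G := by
  classical
  haveI : IsMulCommutative V := ⟨⟨fun a b => Subtype.ext (hVc a a.2 b b.2)⟩⟩
  -- a constituent `ψ` of `χ_V`
  have hχV : IsCharacter V (fun v : V => χ v) := hχ.isCharacter.restrict V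
  have hχV0 : (fun v : V => χ v) ≠ 0 := by
    intro h
    have h1 := congrFun h 1
    simp only [OneMemClass.coe_one, Pi.zero_apply] at h1
    exact hχ.apply_one_ne_zero h1
  obtain ⟨ψ, hψ, hne⟩ := hχV.exists_isIrrChar_classInner_ne_zero hχV0
  obtain ⟨hone, hψ1⟩ := hmult ψ hψ hne
  have hψone : ψ 1 = 1 := hψ.map_one
  -- Clifford correspondence: `χ = η^G`, `η ∈ Irr(T)`, `T = I_G(ψ)`
  have hVT : V ≤ inertia ψ := le_inertia hψ.isCharacter.isClassFun
  obtain ⟨η, hη, hf, hind⟩ := exists_indClassFun_eq_of_inertia hψ hVT rfl hχ hne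
  -- multiplicity: `[η_V, ψ] = [χ_V, ψ] = 1`
  have hf1 : classInner (fun v : V => η (Subgroup.inclusion hVT v)) ψ = 1 := by
    have h2 := (indClassFun_eq_and_classInner_eq_of_constituent hψ hVT rfl hη hf hχ (by
      rw [hind, hχ.classInner_eq hχ, if_pos rfl]; exact one_ne_zero)).2
    rw [← h2, hone]
  -- `η` is linear
  have hη1 : η 1 = 1 := by
    rw [apply_one_eq_classInner_mul_of_le_inertia hψ hVT le_rfl hη hf, hf1, hψone, mul_one]
  obtain ⟨η', hη'⟩ := hη.exists_monoidHom_of_apply_one hη1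
  -- `η_V = ψ`
  have hηV : (fun v : V => η (Subgroup.inclusion hVT v)) = ψ := by
    rw [restrict_inclusion_eq_classInner_smul_of_le_inertia hψ hVT le_rfl hη hf, hf1, one_smul]
  -- `η` is abelian-free
  have haf : ∀ μ : G →* ℂˣ, μ.restrict (inertia ψ) ≠ η' := by
    intro μ hμ
    apply hψ1
    funext v
    have h1 := congrFun hηV v
    rw [← hη'] at h1
    dsimp only at h1
    rw [← hμ, MonoidHom.restrict_apply, Subgroup.coe_inclusion] at h1
    have hv : μ (v : G) = 1 := htriv μ v.2
    rw [Pi.one_apply, ← h1, hv, Units.val_one]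
  have hgen : indClassFun (inertia ψ) (fun t => (η' t : ℂ)) ∈ afSpan G := indClassFun_mem_afSpan haf
  rw [hη', hind] at hgen
  exact hgen

/-- **Induction on the degree.** For `V ⊴ G` commutative with all linear characters of `G`
trivial on `V`: a character `ξ` of `G` all of whose irreducible constituents `ψ` of `ξ_V` are
nontrivial of multiplicity one lies in `J(G)` (peel off an irreducible constituent `χ`; both `χ`
and `ξ - χ` inherit the hypothesis, the multiplicities being natural numbers). [folklore] -/
theorem mem_afSpan_of_mult (V : Subgroup G) [V.Normal] [Fintype V]
    (hVc : ∀ x ∈ V, ∀ y ∈ V, x * y = y * x) (htriv : ∀ μ : G →* ℂˣ, V ≤ μ.ker) :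
    ∀ (n : ℕ) (ξ : G → ℂ), IsCharacter G ξ → ξ 1 = n →
      (∀ ψ : V → ℂ, IsIrrChar V ψ → classInner (fun v : V => ξ v) ψ ≠ 0 →
        classInner (fun v : V => ξ v) ψ = 1 ∧ ψ ≠ 1) → ξ ∈ afSpan G := by
  intro n
  induction n using Nat.strong_induction_on with
  | _ n ih => ?_
  intro ξ hξ hn hmult
  classical
  by_cases h0 : ξ = 0
  · rw [h0]
    exact (afSpan G).zero_mem
  obtain ⟨χ, hχ, hc⟩ := hξ.exists_isIrrChar_classInner_ne_zero h0
  obtain ⟨ξ', hξ', hsplit⟩ := hξ.exists_eq_add_of_classInner_ne_zero hχ hc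
  -- natural-number multiplicities on `V`
  have key : ∀ ψ : V → ℂ, IsIrrChar V ψ →
      ∃ a b : ℕ, classInner (fun v : V => χ v) ψ = a ∧ classInner (fun v : V => ξ' v) ψ = b ∧
        classInner (fun v : V => ξ v) ψ = a + b := by
    intro ψ hψ
    obtain ⟨a, ha⟩ := (hχ.isCharacter.restrict V).classInner_natCast hψ.isCharacter
    obtain ⟨b, hb⟩ := (hξ'.restrict V).classInner_natCast hψ.isCharacter
    refine ⟨a, b, ha, hb, ?_⟩
    have h1 : (fun v : V => ξ v) = (fun v : V => χ v) + fun v : V => ξ' v := by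
      rw [hsplit]; rfl
    rw [h1, classInner_add_left, ha, hb]
  have hχmult : ∀ ψ : V → ℂ, IsIrrChar V ψ → classInner (fun v : V => χ v) ψ ≠ 0 →
      classInner (fun v : V => χ v) ψ = 1 ∧ ψ ≠ 1 := by
    intro ψ hψ hne
    obtain ⟨a, b, ha, hb, hab⟩ := key ψ hψ
    rw [ha] at hne ⊢
    have ha0 : a ≠ 0 := by exact_mod_cast hne
    have hne' : classInner (fun v : V => ξ v) ψ ≠ 0 := by
      rw [hab]; exact_mod_cast (show a + b ≠ 0 by omega)
    obtain ⟨h1, hψ1⟩ := hmult ψ hψ hne'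
    rw [hab] at h1
    have hab1 : a + b = 1 := by exact_mod_cast h1
    exact ⟨by exact_mod_cast (show a = 1 by omega), hψ1⟩
  have hξ'mult : ∀ ψ : V → ℂ, IsIrrChar V ψ → classInner (fun v : V => ξ' v) ψ ≠ 0 →
      classInner (fun v : V => ξ' v) ψ = 1 ∧ ψ ≠ 1 := by
    intro ψ hψ hne
    obtain ⟨a, b, ha, hb, hab⟩ := key ψ hψ
    rw [hb] at hne ⊢
    have hb0 : b ≠ 0 := by exact_mod_cast hne
    have hne' : classInner (fun v : V => ξ v) ψ ≠ 0 := by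
      rw [hab]; exact_mod_cast (show a + b ≠ 0 by omega)
    obtain ⟨h1, hψ1⟩ := hmult ψ hψ hne'
    rw [hab] at h1
    have hab1 : a + b = 1 := by exact_mod_cast h1
    exact ⟨by exact_mod_cast (show b = 1 by omega), hψ1⟩
  have hχmem : χ ∈ afSpan G := constituent_mem_afSpan V hVc htriv hχ hχmult
  -- degrees
  obtain ⟨m, hm⟩ := hξ'.exists_nat_apply_one
  obtain ⟨d, hd⟩ := hχ.isCharacter.exists_nat_apply_one
  have hdpos : d ≠ 0 := by
    rintro rfl
    exact hχ.apply_one_ne_zero (by rw [hd, Nat.cast_zero])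
  have hmn : m < n := by
    have h1 := congrFun hsplit 1
    rw [Pi.add_apply, hn, hd, hm] at h1
    have h2 : n = d + m := by exact_mod_cast h1
    omega
  have hξ'mem : ξ' ∈ afSpan G := ih m hmn ξ' hξ' hm hξ'mult
  rw [hsplit]
  exact (afSpan G).add_mem hχmem hξ'mem

/-- **The affine branch.** `V ⊴ G` commutative, `K` a complement (`V ⊓ K = ⊥`, `V ⊔ K = ⊤`), all
linear characters of `G` trivial on `V`: then `π_K - 1 ∈ J(G)`.  Indeed `π_K - 1` is a character
whose restriction to `V` is `ρ_V - 1_V` (every nontrivial `ψ ∈ Irr(V)` exactly once), and the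
preceding induction applies. [cite: Isaacs1976, Thm. 6.11] -/
theorem indOne_sub_one_mem_afSpan_affine (V K : Subgroup G) [hVn : V.Normal]
    (hVc : ∀ x ∈ V, ∀ y ∈ V, x * y = y * x) (hVK : V ⊓ K = ⊥) (hVK' : V ⊔ K = ⊤)
    (htriv : ∀ μ : G →* ℂˣ, V ≤ μ.ker) : indOne K - 1 ∈ afSpan G := by
  classical
  haveI : IsMulCommutative V := ⟨⟨fun a b => Subtype.ext (hVc a a.2 b b.2)⟩⟩
  -- `[G : K] = |V|`
  have hcompl : V.IsComplement' K := by
    refine Subgroup.isComplement'_of_disjoint_and_mul_eq_univ (disjoint_iff.mpr hVK) ?_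
    rw [← Subgroup.normal_mul, hVK', Subgroup.coe_top]
  have hidx : K.index = Nat.card V := hcompl.index_eq_card
  -- `π_K - 1` is a character `ξ`
  have hπ : IsCharacter G (indOne K) := IsCharacter.indClassFun K isCharacter_one
  have hirr1 : IsIrrChar G (1 : G → ℂ) := (mem_linF.mp one_mem_linF).1
  have hirr1V : IsIrrChar V (1 : V → ℂ) := (mem_linF.mp one_mem_linF).1
  have hc : classInner (indOne K) 1 = 1 := by
    have h := classInner_indClassFun_left K (fun _ : K => (1 : ℂ))
      (isCharacter_one (G := G)).isClassFun
    rw [show indOne K = indClassFun K (fun _ : K => (1 : ℂ)) from rfl, h]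
    have h1K : IsIrrChar K (1 : K → ℂ) := (mem_linF.mp one_mem_linF).1
    exact (h1K.classInner_eq h1K).trans (if_pos rfl)
  obtain ⟨ξ, hξ, hsplit⟩ :=
    hπ.exists_eq_add_of_classInner_ne_zero hirr1 (by rw [hc]; exact one_ne_zero)
  have hξeq : indOne K - 1 = ξ := by rw [hsplit, add_sub_cancel_left]
  rw [hξeq]
  obtain ⟨n, hn⟩ := hξ.exists_nat_apply_one
  refine mem_afSpan_of_mult V hVc htriv n ξ hξ hn fun ψ hψ hne => ?_
  have hψ1 : ψ 1 = 1 := hψ.map_one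
  have hval : classInner (fun v : V => ξ v) ψ = 1 - (if (1 : V → ℂ) = ψ then 1 else 0) := by
    have h1 : (fun v : V => ξ v) = (fun v : V => indOne K v) - fun v : V => (1 : G → ℂ) v := by
      rw [← hξeq]; rfl
    rw [h1, classInner_sub_left', classInner_restrict_indOne V K hVK hidx hψ1]
    congr 1
    exact hirr1V.classInner_eq hψ
  by_cases h1 : (1 : V → ℂ) = ψ
  · exfalso
    apply hne
    rw [hval, if_pos h1, sub_self]
  · refine ⟨by rw [hval, if_neg h1, sub_zero], fun h => h1 h.symm⟩

end Affine

end Summit.Langlands.Langlands.Theorems.AbelianFreeBrauer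

end
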